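import Summits.AtomisticToContinuum.Crystallization.Theorems.PalmUnimodularRigidityLayeredLawsSelectHcpLocalCongruenceSites

/-!
# Local congruence ⇒ global congruence, II: the automorphisms of the contact graph of the hcp star
(stub `stub_localCongruence` of line `mtp-prestress-split-ergodic-frame`, crux `LayeredLawsSelectHcp`,
stmt-AtomisticToContinuum-9226; part 2 of 4)

**The contact graph of the twelve-point hcp star (the anticuboctahedron graph, 24 edges) has exactly
the twelve automorphisms of `D_{3h}`, and each is an isometry of EVERY relaxed star `hcpSite a h`.**
(Unlike the cuboctahedron, no vertex of the anticuboctahedron is distinguished by its link — every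
link is a perfect matching on four vertices — so we do not argue structurally.) An exhaustive
vertex-by-vertex search `autCands` over injective adjacency-preserving partial maps (Boolean, on
precomputed tables `starAdjT`/`siteQT`/`normQT` checked against `siteQ` by `decide`; sound by
`autCands_complete`) is evaluated by the kernel (`decide +kernel`): every complete candidate
preserves the integer metric `siteQ` of part 1, hence all mutual distances and lengths of the struts
for all `(a, h)` (`stub_localCongruenceStarAut`, a registered sub-goal). This is the label-fixing step
of the endgame: a chart only sees WHICH struts touch, and this file says that is enough.

All `[folklore]`.
-/

noncomputable section

namespace Summit.AtomisticToContinuum.Crystallization.Theorems.PalmUnimodularRigidity.LayeredLawsSelectHcp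

open MeasureTheory Set
open Literature.MathematicalPhysics.StatisticalMechanics Literature.Geometry.DiscreteGeometry

/-! ## The automorphisms of the contact graph of the star -/

/-- The adjacency table of the ideal star (touching pairs of labels), precomputed. [folklore] -/
def starAdjT : Fin 12 → Fin 12 → Bool :=
  ![![false, true, true, true, true, false, false, false, false, false, false, false],
    ![true, false, true, true, false, false, false, false, false, false, true, false],
    ![true, true, false, false, false, true, false, false, true, false, false, false],
    ![true, true, false, false, false, false, false, true, false, false, false, true],
    ![true, false, false, false, false, true, true, true, false, false, false, false],
    ![false, false, true, false, true, false, true, false, true, false, false, false],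
    ![false, false, false, false, true, true, false, true, false, true, false, false],
    ![false, false, false, true, true, false, true, false, false, false, false, true],
    ![false, false, true, false, false, true, false, false, false, true, true, false],
    ![false, false, false, false, false, false, true, false, true, false, true, true],
    ![false, true, false, false, false, false, false, false, true, true, false, true],
    ![false, false, false, true, false, false, false, true, false, true, true, false]]

/-- The integer metric table `siteQ` of the star, precomputed. [folklore] -/
def siteQT : Fin 12 → Fin 12 → ℤ × ℤ :=
  ![![(0, 0), (12, 0), (4, 1), (4, 1), (12, 0), (16, 1), (36, 0), (16, 1), (28, 1), (48, 0), (36, 0), (28, 1)],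
    ![(12, 0), (0, 0), (4, 1), (4, 1), (36, 0), (28, 1), (48, 0), (28, 1), (16, 1), (36, 0), (12, 0), (16, 1)],
    ![(4, 1), (4, 1), (0, 0), (0, 4), (16, 1), (12, 0), (28, 1), (12, 4), (12, 0), (28, 1), (16, 1), (12, 4)],
    ![(4, 1), (4, 1), (0, 4), (0, 0), (16, 1), (12, 4), (28, 1), (12, 0), (12, 4), (28, 1), (16, 1), (12, 0)],
    ![(12, 0), (36, 0), (16, 1), (16, 1), (0, 0), (4, 1), (12, 0), (4, 1), (28, 1), (36, 0), (48, 0), (28, 1)],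
    ![(16, 1), (28, 1), (12, 0), (12, 4), (4, 1), (0, 0), (4, 1), (0, 4), (12, 0), (16, 1), (28, 1), (12, 4)],
    ![(36, 0), (48, 0), (28, 1), (28, 1), (12, 0), (4, 1), (0, 0), (4, 1), (16, 1), (12, 0), (36, 0), (16, 1)],
    ![(16, 1), (28, 1), (12, 4), (12, 0), (4, 1), (0, 4), (4, 1), (0, 0), (12, 4), (16, 1), (28, 1), (12, 0)],
    ![(28, 1), (16, 1), (12, 0), (12, 4), (28, 1), (12, 0), (16, 1), (12, 4), (0, 0), (4, 1), (4, 1), (0, 4)],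
    ![(48, 0), (36, 0), (28, 1), (28, 1), (36, 0), (16, 1), (12, 0), (16, 1), (4, 1), (0, 0), (12, 0), (4, 1)],
    ![(36, 0), (12, 0), (16, 1), (16, 1), (48, 0), (28, 1), (36, 0), (28, 1), (4, 1), (12, 0), (0, 0), (4, 1)],
    ![(28, 1), (16, 1), (12, 4), (12, 0), (28, 1), (12, 4), (16, 1), (12, 0), (0, 4), (4, 1), (4, 1), (0, 0)]]

/-- The integer length table `siteQ · 0` of the star, precomputed. [folklore] -/
def normQT : Fin 12 → ℤ × ℤ :=
  ![(12, 0), (12, 0), (4, 1), (4, 1), (12, 0), (4, 1), (12, 0), (4, 1), (4, 1), (12, 0), (12, 0), (4, 1)]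

/-- The adjacency table is the touching relation `q₁ + 8 q₂ = 12`. [folklore] -/
theorem starAdjT_spec : ∀ m n : Fin 12, starAdjT m n =
    decide ((siteQ (starLab m) (starLab n)).1 + 8 * (siteQ (starLab m) (starLab n)).2 = 12) := by
  decide

/-- The metric table is `siteQ`. [folklore] -/
theorem siteQT_spec : ∀ m n : Fin 12, siteQT m n = siteQ (starLab m) (starLab n) := by decide

/-- The length table is `siteQ · 0`. [folklore] -/
theorem normQT_spec : ∀ m : Fin 12, normQT m = siteQ (starLab m) 0 := by decide

/-- All twelve label indices. [folklore] -/
def allLab : List (Fin 12) := [0, 1, 2, 3, 4, 5, 6, 7, 8, 9, 10, 11]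

/-- Every index is listed. [folklore] -/
theorem mem_allLab : ∀ w : Fin 12, w ∈ allLab := by decide

/-- Reassigning one value of a candidate map. [folklore] -/
def setAt (g : Fin 12 → Fin 12) (v w : Fin 12) : Fin 12 → Fin 12 := fun i => if i = v then w else g i

/-- The admissibility test of the search (Boolean, for fast kernel evaluation): the image of vertex
`v` is new and has the right adjacencies to the images of the earlier vertices. [folklore] -/
def autOk (v : Fin 12) (g : Fin 12 → Fin 12) : Bool :=
  allLab.all fun i => !decide (i < v) || (g i != g v && starAdjT (g i) (g v) == starAdjT i v)

/-- One step of the search: extend every candidate at vertex `v` in all admissible ways. [folklore] -/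
def autStep (cands : List (Fin 12 → Fin 12)) (v : Fin 12) : List (Fin 12 → Fin 12) :=
  cands.flatMap fun g => allLab.filterMap fun w =>
    if autOk v (setAt g v w) then some (setAt g v w) else none

/-- **The automorphism search**: after `n` steps, maps (arbitrary beyond vertex `n − 1`) whose
restriction to the first `n` vertices is injective and adjacency-preserving; every such restriction
occurs (`autCands_complete`). [folklore] -/
def autCands : ℕ → List (Fin 12 → Fin 12)
  | 0 => [fun _ => 0]
  | n + 1 => if h : n < 12 then autStep (autCands n) ⟨n, h⟩ else autCands n

/-- **Soundness of the search**: every injective adjacency-preserving map agrees, on the first `n`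
vertices, with some candidate of step `n`. [folklore] -/
theorem autCands_complete {f : Fin 12 → Fin 12} (hinj : Function.Injective f)
    (hadj : ∀ m n, starAdjT (f m) (f n) = starAdjT m n) :
    ∀ n, ∃ g ∈ autCands n, ∀ i : Fin 12, i.val < n → g i = f i := by
  intro n
  induction n with
  | zero => exact ⟨fun _ => 0, by simp [autCands], fun i hi => absurd hi (Nat.not_lt_zero _)⟩
  | succ n ih =>
    obtain ⟨g, hg, hgf⟩ := ih
    by_cases hn : n < 12
    · have hgv : setAt g ⟨n, hn⟩ (f ⟨n, hn⟩) ⟨n, hn⟩ = f ⟨n, hn⟩ := by simp [setAt]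
      have hgi : ∀ i : Fin 12, i.val < n → setAt g ⟨n, hn⟩ (f ⟨n, hn⟩) i = f i := fun i hi => by
        have hne : i ≠ ⟨n, hn⟩ := fun h => by rw [h] at hi; exact lt_irrefl _ hi
        simp only [setAt, if_neg hne, hgf i hi]
      refine ⟨setAt g ⟨n, hn⟩ (f ⟨n, hn⟩), ?_, ?_⟩
      · rw [autCands, dif_pos hn, autStep, List.mem_flatMap]
        refine ⟨g, hg, ?_⟩
        rw [List.mem_filterMap]
        refine ⟨f ⟨n, hn⟩, mem_allLab _, ?_⟩
        have hok : autOk ⟨n, hn⟩ (setAt g ⟨n, hn⟩ (f ⟨n, hn⟩)) = true := by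
          simp only [autOk, List.all_eq_true, Bool.or_eq_true, Bool.not_eq_eq_eq_not, Bool.not_true,
            decide_eq_false_iff_not, Bool.and_eq_true, bne_iff_ne, ne_eq, beq_iff_eq]
          intro i _
          by_cases hi : i < ⟨n, hn⟩
          · have hi' : i.val < n := hi
            refine Or.inr ⟨?_, ?_⟩
            · rw [hgi i hi', hgv]
              intro h
              have hin := hinj h
              rw [hin] at hi'
              exact lt_irrefl _ hi'
            · rw [hgi i hi', hgv, hadj]
          · exact Or.inl hi
        rw [hok, if_pos rfl]
      · intro i hi
        rcases Nat.lt_succ_iff_lt_or_eq.1 hi with hi | hi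
        · exact hgi i hi
        · have : i = ⟨n, hn⟩ := Fin.ext hi
          rw [this, hgv]
    · refine ⟨g, by rw [autCands, dif_neg hn]; exact hg, fun i _ => hgf i ?_⟩
      have := i.2; omega

/-- **The result of the search** (by `decide`, Boolean form): every complete candidate preserves the
integer metric table — the automorphisms of the anticuboctahedron graph are isometries. [folklore] -/
theorem autCands_metricB : ((autCands 12).all fun g => allLab.all fun m => allLab.all fun n =>
    siteQT (g m) (g n) == siteQT m n) = true := by
  decide +kernel

/-- **The result of the search** (by `decide`, Boolean form): every complete candidate preserves the
strut length table. [folklore] -/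
theorem autCands_normB : ((autCands 12).all fun g => allLab.all fun m =>
    normQT (g m) == normQT m) = true := by
  decide +kernel

/-- Every injective adjacency-preserving map of the labels preserves the integer metric. [folklore] -/
theorem aut_siteQ {f : Fin 12 → Fin 12} (hinj : Function.Injective f)
    (hadj : ∀ m n, starAdjT (f m) (f n) = starAdjT m n) :
    (∀ m n : Fin 12, siteQ (starLab (f m)) (starLab (f n)) = siteQ (starLab m) (starLab n)) ∧
      ∀ m : Fin 12, siteQ (starLab (f m)) 0 = siteQ (starLab m) 0 := by
  obtain ⟨g, hg, hgf⟩ := autCands_complete hinj hadj 12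
  have hfg : f = g := funext fun i => (hgf i i.2).symm
  have h1 := autCands_metricB
  have h2 := autCands_normB
  simp only [List.all_eq_true, beq_iff_eq] at h1 h2
  rw [hfg]
  exact ⟨fun m n => by rw [← siteQT_spec, ← siteQT_spec, h1 g hg m (mem_allLab m) n (mem_allLab n)],
    fun m => by rw [← normQT_spec, ← normQT_spec, h2 g hg m (mem_allLab m)]⟩

/-- **Registered sub-goal `stub_localCongruenceStarAut`: every automorphism of the contact graph of
the ideal hcp star is an isometry of every relaxed star.** If `π` maps the twelve labels
`hcpStarIdx` injectively into themselves and preserves touching (`dist = 1`) in the ideal stacking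
`(1, √(2/3))`, then for all `a, h` it preserves all mutual distances and all lengths of the struts
`hcpSite a h v`, `v ∈ hcpStarIdx`. [folklore] -/
theorem stub_localCongruenceStarAut : ∀ a h : ℝ, ∀ π : ℤ × ℤ × ℤ → ℤ × ℤ × ℤ, Set.InjOn π ↑hcpStarIdx → Set.MapsTo π ↑hcpStarIdx ↑hcpStarIdx → (∀ v ∈ hcpStarIdx, ∀ w ∈ hcpStarIdx, (dist (hcpSite 1 (Real.sqrt (2 / 3)) (π v)) (hcpSite 1 (Real.sqrt (2 / 3)) (π w)) = 1 ↔ dist (hcpSite 1 (Real.sqrt (2 / 3)) v) (hcpSite 1 (Real.sqrt (2 / 3)) w) = 1)) → ∀ v ∈ hcpStarIdx, ∀ w ∈ hcpStarIdx, dist (hcpSite a h (π v)) (hcpSite a h (π w)) = dist (hcpSite a h v) (hcpSite a h w) ∧ ‖hcpSite a h (π v)‖ = ‖hcpSite a h v‖ := by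
  intro a h π hinj hmaps hadj
  -- transport `π` to the enumeration
  have hex : ∀ m : Fin 12, ∃ n : Fin 12, starLab n = π (starLab m) := fun m =>
    exists_starLab_eq (hmaps (starLab_mem m))
  choose f hf using hex
  have hfinj : Function.Injective f := fun m m' hmm' => by
    have : π (starLab m) = π (starLab m') := by rw [← hf m, ← hf m', hmm']
    exact starLab_injective (hinj (starLab_mem m) (starLab_mem m') this)
  have hfadj : ∀ m n, starAdjT (f m) (f n) = starAdjT m n := fun m n => by
    have key := hadj _ (starLab_mem m) _ (starLab_mem n)
    rw [← hf m, ← hf n, dist_ideal_eq_one_iff, dist_ideal_eq_one_iff] at key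
    rw [starAdjT_spec, starAdjT_spec, decide_eq_decide]
    exact key
  obtain ⟨hq, hq0⟩ := aut_siteQ hfinj hfadj
  intro v hv w hw
  obtain ⟨m, rfl⟩ := exists_starLab_eq hv
  obtain ⟨n, rfl⟩ := exists_starLab_eq hw
  rw [← hf m, ← hf n]
  constructor
  · have h1 := hcpSite_dist_sq a h (starLab (f m)) (starLab (f n))
    have h2 := hcpSite_dist_sq a h (starLab m) (starLab n)
    rw [hq m n, ← h2] at h1
    exact (sq_eq_sq₀ dist_nonneg dist_nonneg).1 h1
  · have h1 := hcpSite_dist_sq a h (starLab (f m)) 0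
    have h2 := hcpSite_dist_sq a h (starLab m) 0
    rw [hcpSite_zero, dist_zero_right] at h1 h2
    rw [hq0 m, ← h2] at h1
    exact (sq_eq_sq₀ (norm_nonneg _) (norm_nonneg _)).1 h1

end Summit.AtomisticToContinuum.Crystallization.Theorems.PalmUnimodularRigidity.LayeredLawsSelectHcp

end
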